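import Mathlib.LinearAlgebra.Span.Basic
import Mathlib.Algebra.Module.Submodule.Ker
import Mathlib.Algebra.Module.Submodule.Range
import Mathlib.Tactic.Module
import HarnessLib

/-!
# SATURATION SPLITS ALONG A STABLE PROJECTOR: T-V54 at `(pM, 𝔪)` ⟺ T-V54 on the `U_p`-nilpotent (resp. `p`-old) part ∧ T-V54 on its complement (cell `b2b-bsdres`, seat additive-p4 gen 39, line V68 — K118d)

HONEST FRAMING (verbatim, cell `b2b-bsdres`): the goal of the cell is to DELETE the COMBINATION-SHAPED
residual classes for ALL analytic-rank `≤ 1` curves over `ℚ` — "full BSD formula for every rank `≤ 1`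
curve in class `C`" assembled STRICTLY from published theorems — so that the rank-`≤ 1` remainder
becomes exactly the CONSTRUCTION-SHAPED classes, which are TYPED (missing-input Props), NOT attempted;
this is not "finishing BSD". This file: TOOL theorems (pure module algebra; 0 defs, 0 facts, nothing
booked; X4 stays CONSTRUCTION-shaped).

## What is proved

The last algebraic link of Proposition V64-B (memo V64 §3, last display of (B2); memo V68 §1): the
two-prime saturation statement T-V54 — "`S := O_{ℓ₁}(Y) + O_{ℓ₂}(Y)` is `r`-saturated in `Y`", in the
tree's shape `∀ y, r • y ∈ S → y ∈ S` — SPLITS along any linear map `e : Y → Y` that lands in a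
submodule `A`, whose complement `y − e y` lands in a submodule `B`, and which preserves `S`:

* `smul_mem_imp_iff_split` — `(∀ y, r•y ∈ S → y ∈ S) ↔ (∀ a ∈ A, r•a ∈ S → a ∈ S) ∧ (∀ b ∈ B, r•b ∈ S → b ∈ S)`.
  No idempotence, no `A ⊓ B = ⊥`, no finiteness is needed.
* `nilpotentProjector_mem_of_U_mem` / `oldProjector_mem_of_U_mem` — the two explicit projectors of
  `X4/UpNilpotentProjector.lean` (K118a: `e₀ = c • (U − u₁)(U² − 1)`, case (B2)) and
  `X4/UpOldProjector.lean` (K118c: `e₁ = d • (tU + (p+1) − t²)(U² − 1)`, case (B1)) preserve every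
  `U`-stable submodule `S` (they are polynomials in `U`); the old lattices `O_{ℓ_i}(Y)` and their sum are
  `U_p`-stable (degeneracies at `ℓ_i` commute with `U_p`), so the hypothesis `hS` of the splitting holds.
* `tv54_split_caseB2` / `tv54_split_caseB1` — the splitting SPECIALISED to the two projectors, with
  `A`/`B` the kernels of K118a/K118c (`ker(U − u₀)` / `ker((U − u₁)(U² − 1))`, resp.
  `ker(U² − tU + p)` / `ker(U² − 1)`), taking as hypotheses exactly the two pointwise facts those files
  prove (`U (e y) = u₀ • e y` resp. the quadratic on `e₁ y`, and the complement relation on `y − e y`) —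
  so that this file is Mathlib-only and independent of the farm's build order; instantiate with K118a's
  `U_projector_apply` / `cubic_apply_sub_projector` and K118c's `quadratic_apply_oldProjector` /
  `sq_sub_one_apply_sub_oldProjector`.

With K108 (devissage), K110 (trace), K114/K115/K118a–c this makes "T-V54 @ (pM, 𝔪) ⟺ T-V54 @ (M, 𝔪)
∧ T-V54 on the complement (the ordinary ideals in case (B2) / the `p`-new vectors at `𝔪` in case (B1))"
a chain of kernel theorems whose displayed inputs are convention (A), `hAL`, Ihara at `p ∤ M`, one unit
of `𝕋(M)_𝔪`, and the identification of the old lattices.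

## References (context only; the proofs are elementary)

* A. Wiles, Ann. of Math. 141 (1995), §2 (the `p`-old pair and `U_p`). [cite: Wiles1995, §2]
-/

namespace Summit.BirchSwinnertonDyer.Rank1Residual.LevelLowering

section Split

variable {R Y : Type*} [CommRing R] [AddCommGroup Y] [Module R Y]

/-- **Saturation splits along a stable projector.** If `e : Y → Y` lands in `A`, `y − e y` lands in
`B`, and `e` preserves `S`, then `S` is `r`-saturated in `Y` iff it is `r`-saturated on `A` and on `B`.
[cite: Wiles1995, §2] -/
theorem smul_mem_imp_iff_split (e : Y →ₗ[R] Y) (A B S : Submodule R Y)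
    (hA : ∀ y, e y ∈ A) (hB : ∀ y, y - e y ∈ B) (hS : ∀ s ∈ S, e s ∈ S) (r : R) :
    (∀ y : Y, r • y ∈ S → y ∈ S) ↔
      (∀ a ∈ A, r • a ∈ S → a ∈ S) ∧ (∀ b ∈ B, r • b ∈ S → b ∈ S) := by
  constructor
  · intro h
    exact ⟨fun a _ ha => h a ha, fun b _ hb => h b hb⟩
  · rintro ⟨hAs, hBs⟩ y hy
    have h1 : r • e y ∈ S := by rw [← map_smul]; exact hS _ hy
    have h2 : e y ∈ S := hAs (e y) (hA y) h1
    have h3 : r • (y - e y) ∈ S := by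
      rw [smul_sub]; exact S.sub_mem hy h1
    have h4 : y - e y ∈ S := hBs (y - e y) (hB y) h3
    rw [← add_sub_cancel (e y) y]
    exact S.add_mem h2 h4

/-- The case-(B2) projector `e₀ = c • (U − u₁)(U² − 1)` (K118a) preserves every `U`-stable submodule. -/
theorem nilpotentProjector_mem_of_U_mem (u₁ c : R) (U : Y →ₗ[R] Y) (S : Submodule R Y)
    (hU : ∀ s ∈ S, U s ∈ S) (s : Y) (hs : s ∈ S) :
    (c • ((U - u₁ • 1) * (U * U - 1))) s ∈ S := by
  have hz : U (U s) - s ∈ S := S.sub_mem (hU _ (hU s hs)) hs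
  have he : (c • ((U - u₁ • 1) * (U * U - 1))) s = c • (U (U (U s) - s) - u₁ • (U (U s) - s)) := by
    simp only [Module.End.mul_apply, LinearMap.sub_apply, LinearMap.smul_apply, Module.End.one_apply]
  rw [he]
  exact S.smul_mem c (S.sub_mem (hU _ hz) (S.smul_mem u₁ hz))

/-- The case-(B1) projector `e₁ = d • (tU + ((p+1) − t²))(U² − 1)` (K118c) preserves every `U`-stable
submodule. -/
theorem oldProjector_mem_of_U_mem (t p d : R) (U : Y →ₗ[R] Y) (S : Submodule R Y)
    (hU : ∀ s ∈ S, U s ∈ S) (s : Y) (hs : s ∈ S) :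
    (d • ((t • U + ((p + 1) - t * t) • 1) * (U * U - 1))) s ∈ S := by
  have hz : U (U s) - s ∈ S := S.sub_mem (hU _ (hU s hs)) hs
  have he : (d • ((t • U + ((p + 1) - t * t) • 1) * (U * U - 1))) s
      = d • (t • U (U (U s) - s) + ((p + 1) - t * t) • (U (U s) - s)) := by
    simp only [LinearMap.smul_apply, Module.End.mul_apply, LinearMap.add_apply, LinearMap.sub_apply,
      Module.End.one_apply]
  rw [he]
  exact S.smul_mem d (S.add_mem (S.smul_mem t (hU _ hz)) (S.smul_mem _ hz))

/-- **T-V54 splits in case (B2)** (`a_p(ρ̄) ≠ 0`): with `e₀ = c • (U − u₁)(U² − 1)` satisfying K118a's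
`U (e₀ y) = u₀ • e₀ y` (`hA'`) and `(U − u₁)(U² − 1)(y − e₀ y) = 0` (`hB'`), a `U`-stable `S`
(e.g. `O_{ℓ₁}(Y) + O_{ℓ₂}(Y)`) is `r`-saturated in `Y` iff it is so on the nilpotent part `ker(U − u₀)`
and on the complement `ker((U − u₁)(U² − 1))` (the ordinary ideals). [cite: Wiles1995, §2] -/
theorem tv54_split_caseB2 (u₀ u₁ c : R) (U : Y →ₗ[R] Y) (S : Submodule R Y)
    (hU : ∀ s ∈ S, U s ∈ S)
    (hA' : ∀ y, U ((c • ((U - u₁ • 1) * (U * U - 1))) y)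
      = u₀ • (c • ((U - u₁ • 1) * (U * U - 1))) y)
    (hB' : ∀ y, ((U - u₁ • 1) * (U * U - 1)) (y - (c • ((U - u₁ • 1) * (U * U - 1))) y) = 0)
    (r : R) :
    (∀ y : Y, r • y ∈ S → y ∈ S) ↔
      (∀ a ∈ LinearMap.ker (U - u₀ • 1), r • a ∈ S → a ∈ S)
      ∧ (∀ b ∈ LinearMap.ker ((U - u₁ • 1) * (U * U - 1)), r • b ∈ S → b ∈ S) := by
  refine smul_mem_imp_iff_split (c • ((U - u₁ • 1) * (U * U - 1))) _ _ S ?_ ?_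
    (nilpotentProjector_mem_of_U_mem u₁ c U S hU) r
  · intro y
    have h := hA' y
    simp only [LinearMap.mem_ker, LinearMap.sub_apply, LinearMap.smul_apply, Module.End.one_apply] at h ⊢
    rw [h, sub_self]
  · intro y
    exact hB' y

/-- **T-V54 splits in case (B1)** (`t² − (p+1)²` a unit, e.g. `a₃(ρ̄) = 0`): with
`e₁ = d • (tU + ((p+1) − t²))(U² − 1)` satisfying K118c's quadratic relation on `e₁ y` (`hA'`) and
`(U² − 1)(y − e₁ y) = 0` (`hB'`), a `U`-stable `S` is `r`-saturated in `Y` iff it is so on the `p`-old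
part `ker(U² − tU + p)` (`= j′(K × K)`) and on `ker(U² − 1)` (the `p`-new vectors at `𝔪`).
[cite: Wiles1995, §2] -/
theorem tv54_split_caseB1 (t p d : R) (U : Y →ₗ[R] Y) (S : Submodule R Y)
    (hU : ∀ s ∈ S, U s ∈ S)
    (hA' : ∀ y, U (U ((d • ((t • U + ((p + 1) - t * t) • 1) * (U * U - 1))) y))
      = t • U ((d • ((t • U + ((p + 1) - t * t) • 1) * (U * U - 1))) y)
        - p • (d • ((t • U + ((p + 1) - t * t) • 1) * (U * U - 1))) y)
    (hB' : ∀ y, U (U (y - (d • ((t • U + ((p + 1) - t * t) • 1) * (U * U - 1))) y))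
      - (y - (d • ((t • U + ((p + 1) - t * t) • 1) * (U * U - 1))) y) = 0)
    (r : R) :
    (∀ y : Y, r • y ∈ S → y ∈ S) ↔
      (∀ a ∈ LinearMap.ker (U * U - t • U + p • 1), r • a ∈ S → a ∈ S)
      ∧ (∀ b ∈ LinearMap.ker (U * U - 1), r • b ∈ S → b ∈ S) := by
  refine smul_mem_imp_iff_split (d • ((t • U + ((p + 1) - t * t) • 1) * (U * U - 1))) _ _ S ?_ ?_
    (oldProjector_mem_of_U_mem t p d U S hU) r
  · intro y
    have h := hA' y
    simp only [LinearMap.mem_ker, LinearMap.add_apply, LinearMap.sub_apply, Module.End.mul_apply,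
      LinearMap.smul_apply, Module.End.one_apply] at h ⊢
    rw [h]
    module
  · intro y
    have h := hB' y
    simp only [LinearMap.mem_ker, LinearMap.sub_apply, Module.End.mul_apply, Module.End.one_apply,
      LinearMap.smul_apply, LinearMap.add_apply] at h ⊢
    exact h

end Split

section Involution

variable {R Y : Type*} [CommRing R] [AddCommGroup Y] [Module R Y]

/-! ### Appendix (gen 39, second landing): saturation splits along an INVOLUTION commuting with the lattices — the ATKIN–LEHNER split

Instrument E18 v1.9 (P-AL, EVIDENCE) found on the Kodaira-III row 23265i1 that the multiplicity-two block
`X² ⊗ 𝔽₃` ((s,μ) = (2,2)) splits under the Atkin–Lehner involution `W₉` into two eigenspaces EACH of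
multiplicity one ((6,1,1) ⊕ (10,1,1)). The lemma below is the kernel form of the consequence: for an
involution `W` (`W² = 1`, `2 ∈ R^×`) preserving `S = O_{ℓ₁} + O_{ℓ₂}` (Atkin–Lehner at `p` commutes with the
`ℓ_i`-degeneracies, `ℓ_i ≠ p`), T-V54 for `S` splits into T-V54 on `ker(W − 1)` and on `ker(W + 1)` —
two multiplicity-ONE problems (the θ-packet and the twisted-Steinberg packet), to which the V58 / V64-D
templates apply separately. -/

/-- **T-V54 splits along an involution**: `W² = 1`, `h·2 = 1`, `W(S) ≤ S` ⇒ (`S` is `r`-saturated in `Y`)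
↔ (on `ker(W − 1)`) ∧ (on `ker(W + 1)`), via the projector `e = h • (1 + W)`. [cite: Wiles1995, §2] -/
theorem tv54_split_involution (W : Y →ₗ[R] Y) (hW : ∀ y, W (W y) = y) (h : R) (h2 : h * 2 = 1)
    (S : Submodule R Y) (hS : ∀ s ∈ S, W s ∈ S) (r : R) :
    (∀ y : Y, r • y ∈ S → y ∈ S) ↔
      (∀ a ∈ LinearMap.ker (W - 1), r • a ∈ S → a ∈ S)
      ∧ (∀ b ∈ LinearMap.ker (W + 1), r • b ∈ S → b ∈ S) := by
  refine smul_mem_imp_iff_split (h • (1 + W)) _ _ S ?_ ?_ ?_ r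
  · intro y
    simp only [LinearMap.mem_ker, LinearMap.sub_apply, LinearMap.smul_apply, LinearMap.add_apply,
      Module.End.one_apply, map_smul, map_add, hW]
    module
  · intro y
    simp only [LinearMap.mem_ker, LinearMap.add_apply, LinearMap.smul_apply, Module.End.one_apply,
      map_sub, map_smul, map_add, hW]
    -- (1 + W)(y − h(y + Wy)) = (1 − 2h)(y + Wy) = 0
    have : W y + y - h • (W y + y + (y + W y)) = (1 - h * 2) • (W y + y) := by module
    rw [this, h2, sub_self, zero_smul]
  · intro s hs
    simp only [LinearMap.smul_apply, LinearMap.add_apply, Module.End.one_apply]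
    exact S.smul_mem h (S.add_mem hs (hS s hs))

end Involution

end Summit.BirchSwinnertonDyer.Rank1Residual.LevelLowering
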